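/-
Copyright (c) 2026 the pub-hodgecm-mathlib formalisation cell (harness21).  Prover seat hodgecm-mathlib-K2-defs1 (g6), Track B, h413 = `stmt-HodgeConjecture-24833`, route `HCCMUnconditional`,
campaign «5Res (b) BL-2(χ,τ)», SHEET row 12d-I (dealer K2E1-plan (g7) (140) 2026-09-04T11:34:53Z «12d-I NOW, then 12d-C»).
-/
import Mathlib.MeasureTheory.Group.Measure
import Mathlib.MeasureTheory.Integral.Bochner.Basic
import Mathlib.Analysis.Complex.Basic
import HarnessLib

/-!
# 5Res (b) row 12d-I — `K2E1EquivariantSectionLine`: `(B, c_B; K, ω)`-EQUIVARIANT FUNCTIONS ON A GROUP WITH `G = B·K` FORM A LINE, AND EVERY `K`-CENTRAL RIGHT CONVOLUTION ACTS ON IT BY A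
# SCALAR (group-generic; the archimedean instance `G = U(1,1)(L ⊗ ℝ)`, `B·K_∞ = G` is row 12d-C's §0)

Cell `pub/hodgecm-mathlib`, crux H413 = `stmt-HodgeConjecture-24833`.  THEOREMS ONLY (no `def`, no `instance`, no notation, no named-fact hypothesis, no `sorry`); lane `--supports
stmt-HodgeConjecture-24833 --as helper` (count-neutral).  Closes no socket.  Mathlib only; any group `G`, any subgroups `B`, `K`, any functions `c_B, ω : G → ℂ`.

THE MATHEMATICS ([BernsteinLapid2019, §4 Claim 1]; [Knapp1986, VII §1]; [MoeglinWaldspurger1995, I.2.17]).  Call `A : G → ℂ` a SECTION when `A(b g) = c_B(b)·A(g)` (`b ∈ B`) and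
`A(g k) = ω(k)·A(g)` (`k ∈ K`).  If `G = B·K` (`hBK`), then (§1) `A(b k) = c_B(b)·ω(k)·A(1)`, so any two sections are PROPORTIONAL: `A(g)·A′(1) = A′(g)·A(1)` — the sections form a LINE
through the origin (the archimedean multiplicity one «`dim Hom_{K_∞}(τ, I(χ_∞, z)) = 1` for `U(1,1)`», the `dim = 1` case of ★ row 9's double-coset count).  (§2) Any map `R` on functions that is
homogeneous (`R(c·A) = c·R(A)`) and sends sections to sections acts on the line by ONE scalar: `R A = c·A` for all sections `A`, with `c = (R A₁)(1)∕A₁(1)` for any section `A₁` with `A₁(1) ≠ 0`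
(and `c` arbitrary if all sections vanish).  (§3) The right convolution `(R_h A)(g) = ∫ h(y)·A(g y) dμ(y)` by a `K`-CENTRAL kernel (`h(k⁻¹ y k) = h(y)`) against a left- and right-invariant
measure `μ` sends sections to sections (left equivariance is free; right equivariance by the substitution `y ↦ k⁻¹ y k`), hence (§4) acts on sections by the scalar `ĥ := (∫ h·A₁ dμ)∕A₁(1)`.
Row 12d-C instantiates `G = U(1,1)(L ⊗ ℝ)` (★ `UnitaryGroup.arch`), `B` = upper triangular, `K = K_∞`, `hBK` = ★ arch Iwasawa, `c_B = χ_∞·‖·‖^z`, `ω = τ`, `h = h_∞` symmetric real `K_∞`-central,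
and transports the scalar to `V(χ, K′, ω)` through the slices `a ↦ f_z^φ(ι(a)·x_f)` and ★ Fubini `exists_integral_archPart_mul_finPart`.
* §1 `section_apply_mul` (`A(b k) = c_B(b)ω(k)A(1)`-type evaluation), **`section_mul_apply_one_eq`** (proportionality), `section_eq_zero_of_apply_one_eq_zero`.
* §2 **`exists_scalar_of_mapsTo_sections`** (homogeneous `R` preserving sections acts by one scalar).
* §3 `rightConv_smul`, **`rightConv_section`** (`R_h` preserves sections for `K`-central `h`, `μ` two-sided invariant).
* §4 HEAD **`exists_rightConv_eq_smul_of_central`** (`∃ ĥ, ∀` section `A`, `R_h A = ĥ • A`), `rightConv_eq_smul_of_apply_one_ne_zero` (the value of `ĥ`).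
HONEST LABEL: HC_CM is proved only modulo the 7 printed citations (2 remaining named inputs: hLiu418 = `stmt-HodgeConjecture-24832`, h413 = `stmt-HodgeConjecture-24833`) until rung 0
closes; count-neutral helper, closes no socket.

## References
* [BernsteinLapid2019] J. Bernstein, E. Lapid, *On the meromorphic continuation of Eisenstein series*, J. Amer. Math. Soc. 37 (2024) (arXiv:1911.02342), §4 Claim 1.
* [Knapp1986] A. W. Knapp, *Representation Theory of Semisimple Groups* (1986), VII §1 (Iwasawa coordinates; `K`-types of the principal series).
* [MoeglinWaldspurger1995] C. Mœglin, J.-L. Waldspurger, *Spectral Decomposition and Eisenstein Series* (1995), I.2.17.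
-/

set_option autoImplicit false
-- the mandated namespace repeats the single-problem summit's segment (`HodgeConjecture.HodgeConjecture`)
set_option linter.dupNamespace false

noncomputable section

open MeasureTheory

namespace Summit.HodgeConjecture.HodgeConjecture.Cruxes.H413.K2E1EquivariantSectionLine

variable {G : Type*} [Group G] (B K : Subgroup G) (cB ω : G → ℂ)

/-! ## §1 Sections on `G = B·K` form a line -/

/-- **Evaluation on `B·K`**: a section takes the value `A(b k) = c_B(b)·(ω(k)·A(1))` on a product `b k`. [cite: Knapp1986, VII §1] -/
theorem section_apply_mul {A : G → ℂ} (hAB : ∀ b ∈ B, ∀ g, A (b * g) = cB b * A g) (hAK : ∀ k ∈ K, ∀ g, A (g * k) = ω k * A g)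
    {b k : G} (hb : b ∈ B) (hk : k ∈ K) : A (b * k) = cB b * (ω k * A 1) := by
  rw [hAB b hb, show k = 1 * k from (one_mul k).symm, hAK k hk, one_mul]

/-- **SECTIONS ARE PROPORTIONAL** (`G = B·K`): `A(g)·A′(1) = A′(g)·A(1)` for any two sections `A, A′` — the space of sections is a line through `0` (archimedean multiplicity one).
[cite: Knapp1986, VII §1] [cite: MoeglinWaldspurger1995, I.2.17] -/
theorem section_mul_apply_one_eq (hBK : ∀ g : G, ∃ b ∈ B, ∃ k ∈ K, g = b * k)
    {A A' : G → ℂ} (hAB : ∀ b ∈ B, ∀ g, A (b * g) = cB b * A g) (hAK : ∀ k ∈ K, ∀ g, A (g * k) = ω k * A g)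
    (hA'B : ∀ b ∈ B, ∀ g, A' (b * g) = cB b * A' g) (hA'K : ∀ k ∈ K, ∀ g, A' (g * k) = ω k * A' g) (g : G) :
    A g * A' 1 = A' g * A 1 := by
  obtain ⟨b, hb, k, hk, rfl⟩ := hBK g
  rw [section_apply_mul B K cB ω hAB hAK hb hk, section_apply_mul B K cB ω hA'B hA'K hb hk]
  ring

/-- A section vanishing at `1` vanishes identically (`G = B·K`). [cite: Knapp1986, VII §1] -/
theorem section_eq_zero_of_apply_one_eq_zero (hBK : ∀ g : G, ∃ b ∈ B, ∃ k ∈ K, g = b * k)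
    {A : G → ℂ} (hAB : ∀ b ∈ B, ∀ g, A (b * g) = cB b * A g) (hAK : ∀ k ∈ K, ∀ g, A (g * k) = ω k * A g) (h1 : A 1 = 0) : A = 0 := by
  funext g
  obtain ⟨b, hb, k, hk, rfl⟩ := hBK g
  rw [section_apply_mul B K cB ω hAB hAK hb hk, h1, mul_zero, mul_zero, Pi.zero_apply]

/-- A section is the multiple `A = (A(1)∕A₁(1))·A₁` of any section `A₁` with `A₁(1) ≠ 0` (`G = B·K`). [cite: Knapp1986, VII §1] -/
theorem section_eq_smul (hBK : ∀ g : G, ∃ b ∈ B, ∃ k ∈ K, g = b * k)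
    {A₁ : G → ℂ} (h₁B : ∀ b ∈ B, ∀ g, A₁ (b * g) = cB b * A₁ g) (h₁K : ∀ k ∈ K, ∀ g, A₁ (g * k) = ω k * A₁ g) (h₁ : A₁ 1 ≠ 0)
    {A : G → ℂ} (hAB : ∀ b ∈ B, ∀ g, A (b * g) = cB b * A g) (hAK : ∀ k ∈ K, ∀ g, A (g * k) = ω k * A g) :
    A = (A 1 / A₁ 1) • A₁ := by
  funext g
  rw [Pi.smul_apply, smul_eq_mul, div_mul_eq_mul_div, eq_div_iff h₁, mul_comm (A 1)]
  exact section_mul_apply_one_eq B K cB ω hBK hAB hAK h₁B h₁K g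

/-! ## §2 A homogeneous map preserving sections acts on them by one scalar -/

/-- **ONE SCALAR FOR ALL SECTIONS**: if `R` is homogeneous (`R (c • A) = c • R A`) and maps sections to sections, there is `ĉ : ℂ` with `R A = ĉ • A` for EVERY section `A` (`G = B·K`; if some section
has `A₁(1) ≠ 0` then `ĉ = (R A₁)(1)∕A₁(1)`, otherwise all sections vanish). [cite: BernsteinLapid2019, §4 Claim 1] [cite: Knapp1986, VII §1] -/
theorem exists_scalar_of_mapsTo_sections (hBK : ∀ g : G, ∃ b ∈ B, ∃ k ∈ K, g = b * k) (R : (G → ℂ) → (G → ℂ))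
    (hRs : ∀ (c : ℂ) (A : G → ℂ), R (c • A) = c • R A)
    (hR : ∀ A : G → ℂ, (∀ b ∈ B, ∀ g, A (b * g) = cB b * A g) → (∀ k ∈ K, ∀ g, A (g * k) = ω k * A g) →
      (∀ b ∈ B, ∀ g, R A (b * g) = cB b * R A g) ∧ (∀ k ∈ K, ∀ g, R A (g * k) = ω k * R A g)) :
    ∃ ĉ : ℂ, ∀ A : G → ℂ, (∀ b ∈ B, ∀ g, A (b * g) = cB b * A g) → (∀ k ∈ K, ∀ g, A (g * k) = ω k * A g) → R A = ĉ • A := by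
  by_cases hex : ∃ A₁ : G → ℂ, (∀ b ∈ B, ∀ g, A₁ (b * g) = cB b * A₁ g) ∧ (∀ k ∈ K, ∀ g, A₁ (g * k) = ω k * A₁ g) ∧ A₁ 1 ≠ 0
  · obtain ⟨A₁, h₁B, h₁K, h₁⟩ := hex
    refine ⟨R A₁ 1 / A₁ 1, fun A hAB hAK => ?_⟩
    have hA : A = (A 1 / A₁ 1) • A₁ := section_eq_smul B K cB ω hBK h₁B h₁K h₁ hAB hAK
    have hR₁ : R A₁ = (R A₁ 1 / A₁ 1) • A₁ := section_eq_smul B K cB ω hBK h₁B h₁K h₁ (hR A₁ h₁B h₁K).1 (hR A₁ h₁B h₁K).2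
    rw [hA, hRs]
    conv_lhs => rw [hR₁]
    rw [smul_smul, smul_smul, mul_comm]
  · refine ⟨0, fun A hAB hAK => ?_⟩
    have h1 : A 1 = 0 := by
      by_contra h
      exact hex ⟨A, hAB, hAK, h⟩
    have hA : A = 0 := section_eq_zero_of_apply_one_eq_zero B K cB ω hBK hAB hAK h1
    have h0 : R 0 = 0 := by
      have := hRs 0 0
      rwa [zero_smul, zero_smul] at this
    rw [hA, h0, zero_smul]

/-! ## §3 Right convolution by a `K`-central kernel preserves sections -/

section Conv

variable [MeasurableSpace G] (μ : Measure G)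

/-- Right convolution is homogeneous in the convolved function: `R_h (c • A) = c • R_h A` (no integrability needed). [folklore] -/
theorem rightConv_smul (h : G → ℂ) (c : ℂ) (A : G → ℂ) :
    (fun g => ∫ y, h y * (c • A) (g * y) ∂μ) = c • fun g => ∫ y, h y * A (g * y) ∂μ := by
  funext g
  simp only [Pi.smul_apply, smul_eq_mul, ← integral_const_mul]
  exact integral_congr_ae (Filter.Eventually.of_forall fun y => by ring)

/-- **RIGHT CONVOLUTION BY A `K`-CENTRAL KERNEL PRESERVES SECTIONS**: for `h` with `h(k⁻¹ y k) = h(y)` (`k ∈ K`) and a measure `μ` invariant under left AND right translations (so under conjugation by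
`k`), `R_h A (g) := ∫ h(y) A(g y) dμ(y)` is again a section: left equivariance is free, right equivariance by the substitution `y ↦ k⁻¹ y k` (Mathlib `map_mul_left_eq_self`, `map_mul_right_eq_self`,
`integral_map`). [cite: BernsteinLapid2019, §4 Claim 1] [cite: Knapp1986, VII §1] -/
theorem rightConv_section [MeasurableMul G] [μ.IsMulLeftInvariant] [μ.IsMulRightInvariant] {h : G → ℂ}
    (hcent : ∀ k ∈ K, ∀ y, h (k⁻¹ * y * k) = h y)
    {A : G → ℂ} (hAB : ∀ b ∈ B, ∀ g, A (b * g) = cB b * A g) (hAK : ∀ k ∈ K, ∀ g, A (g * k) = ω k * A g) :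
    (∀ b ∈ B, ∀ g, (fun g => ∫ y, h y * A (g * y) ∂μ) (b * g) = cB b * (fun g => ∫ y, h y * A (g * y) ∂μ) g) ∧
      (∀ k ∈ K, ∀ g, (fun g => ∫ y, h y * A (g * y) ∂μ) (g * k) = ω k * (fun g => ∫ y, h y * A (g * y) ∂μ) g) := by
  refine ⟨fun b hb g => ?_, fun k hk g => ?_⟩
  · dsimp only
    rw [← integral_const_mul]
    exact integral_congr_ae (Filter.Eventually.of_forall fun y => by dsimp only; rw [mul_assoc b g y, hAB b hb, mul_left_comm])
  · dsimp only
    -- substitute `y ↦ k⁻¹ * y * k` (a measurable equivalence preserving the two-sided invariant `μ`)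
    set e : G ≃ᵐ G := (MeasurableEquiv.mulLeft k⁻¹).trans (MeasurableEquiv.mulRight k) with he
    have hecoe : ∀ y, e y = k⁻¹ * y * k := fun _ => rfl
    have hmap : μ.map e = μ := by
      rw [show (⇑e) = (fun y : G => y * k) ∘ (fun y : G => k⁻¹ * y) from funext fun y => rfl,
        ← Measure.map_map (measurable_mul_const k) (measurable_const_mul k⁻¹), map_mul_left_eq_self, map_mul_right_eq_self]
    calc ∫ y, h y * A (g * k * y) ∂μ = ∫ y, h y * A (g * k * y) ∂(μ.map e) := by rw [hmap]
      _ = ∫ y, h (e y) * A (g * k * e y) ∂μ := integral_map_equiv e _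
      _ = ω k * ∫ y, h y * A (g * y) ∂μ := by
          rw [← integral_const_mul]
          refine integral_congr_ae (Filter.Eventually.of_forall fun y => ?_)
          dsimp only
          rw [hecoe, hcent k hk y, show g * k * (k⁻¹ * y * k) = g * y * k by group, hAK k hk (g * y)]
          ring

/-! ## §4 HEAD: a `K`-central right convolution acts on sections by one scalar -/

/-- **ROW 12d-I HEAD — ONE SCALAR `ĥ`**: on a group `G = B·K`, right convolution by a `K`-central kernel against a two-sided invariant measure acts on ALL `(B, c_B; K, ω)`-sections by one and the
same scalar: `∃ ĥ, ∀` section `A`, `R_h A = ĥ • A` (§2 + §3).  The archimedean multiplicity-one mechanism behind «an archimedean-only test function acts on `V(χ, K′, ω)` by a scalar» (row 12d-C).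
[cite: BernsteinLapid2019, §4 Claim 1] [cite: Knapp1986, VII §1] [cite: MoeglinWaldspurger1995, I.2.17] -/
theorem exists_rightConv_eq_smul_of_central [MeasurableMul G] [μ.IsMulLeftInvariant] [μ.IsMulRightInvariant]
    (hBK : ∀ g : G, ∃ b ∈ B, ∃ k ∈ K, g = b * k) {h : G → ℂ} (hcent : ∀ k ∈ K, ∀ y, h (k⁻¹ * y * k) = h y) :
    ∃ ĥ : ℂ, ∀ A : G → ℂ, (∀ b ∈ B, ∀ g, A (b * g) = cB b * A g) → (∀ k ∈ K, ∀ g, A (g * k) = ω k * A g) →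
      (fun g => ∫ y, h y * A (g * y) ∂μ) = ĥ • A :=
  exists_scalar_of_mapsTo_sections B K cB ω hBK (fun A g => ∫ y, h y * A (g * y) ∂μ) (fun c A => rightConv_smul μ h c A)
    (fun _ hAB hAK => rightConv_section B K cB ω μ hcent hAB hAK)

/-- **THE VALUE OF THE SCALAR**: if a section `A₁` has `A₁(1) ≠ 0`, the scalar of the previous theorem is `ĥ = (∫ h·A₁ dμ)∕A₁(1)` (so `ĥ` is an integral transform of the kernel — entire in the
parameters of `c_B`, as row 12d-C needs for ★ 12c's non-constancy). [cite: BernsteinLapid2019, §4 Claim 1] [cite: Knapp1986, VII §1] -/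
theorem rightConv_eq_smul_of_apply_one_ne_zero [MeasurableMul G] [μ.IsMulLeftInvariant] [μ.IsMulRightInvariant]
    (hBK : ∀ g : G, ∃ b ∈ B, ∃ k ∈ K, g = b * k) {h : G → ℂ} (hcent : ∀ k ∈ K, ∀ y, h (k⁻¹ * y * k) = h y)
    {A₁ : G → ℂ} (h₁B : ∀ b ∈ B, ∀ g, A₁ (b * g) = cB b * A₁ g) (h₁K : ∀ k ∈ K, ∀ g, A₁ (g * k) = ω k * A₁ g) (h₁ : A₁ 1 ≠ 0)
    {A : G → ℂ} (hAB : ∀ b ∈ B, ∀ g, A (b * g) = cB b * A g) (hAK : ∀ k ∈ K, ∀ g, A (g * k) = ω k * A g) :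
    (fun g => ∫ y, h y * A (g * y) ∂μ) = ((∫ y, h y * A₁ y ∂μ) / A₁ 1) • A := by
  obtain ⟨ĥ, hĥ⟩ := exists_rightConv_eq_smul_of_central B K cB ω μ hBK hcent
  have hval : ĥ = (∫ y, h y * A₁ y ∂μ) / A₁ 1 := by
    have h1 := congrFun (hĥ A₁ h₁B h₁K) 1
    simp only [one_mul, Pi.smul_apply, smul_eq_mul] at h1
    rw [eq_div_iff h₁, ← h1]
  rw [hĥ A hAB hAK, hval]

end Conv


end Summit.HodgeConjecture.HodgeConjecture.Cruxes.H413.K2E1EquivariantSectionLine
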